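import Summits.ValiantsHypothesis.ValiantsHypothesis.Theorems.SymPencilHomogeneousDropTools
import Literature.Computability.AlgebraicComplexity.LandsbergRessayreNormalForm

/-!
# Route `SymPencil` — the symmetric normal form at the origin, block by block
# (tool file for the rung `sdc(per_4) ≥ 18`, `--supports` stmt-ValiantsHypothesis-5674)

Let `A₀` be a symmetric matrix on `Unit ⊕ ι'` of rank `≥ |ι'|` with kernel vector `w`,
`w_{inl} ≠ 0`, and `M : V → Sym` a linear family.  With the congruence matrix `P` whose first
column is `w` (as in `SymPencilKernelFixedRank`), `Pᵀ A₀ P = 0 ⊕ D` with `D = (A₀)₂₂` invertible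
and `Pᵀ M(z) P = [[a(z), b(z)ᵀ],[b(z), C(z)]]` with

  `a(z) = wᵀ M(z) w`,  `b(z)_i = (M(z) w)_{inr i}`,  `C(z) = (M(z))₂₂`,

so that for every scalar `s` (`det_origin_blocks`)

  `w_{inl}² · det (A₀ + s M(z)) = det [[s a(z), s b(z)ᵀ], [s b(z), D + s C(z)]]`.

Combined with homogeneity `det (A₀ + s M(z)) = s⁴ f(z)` this is the input `(E)` of
`SymPencilOriginMoments.moments_four`.  Bookkeeping only; the block identities are those of
`SymPencilKernelFixedRank.rank_le_two_of_kernelRow_sum`. [folklore]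
-/

noncomputable section

-- single-conjunct layout: Sub = Summit, duplicated namespace component intended
set_option linter.dupNamespace false

namespace Summit.ValiantsHypothesis.ValiantsHypothesis.Theorems.SymPencilOriginNormalForm

open Matrix
open Literature.Computability.AlgebraicComplexity
open Summit.ValiantsHypothesis.ValiantsHypothesis.Theorems.SymPencilHomogeneousDropTools

universe u

variable {k : Type u} [Field k] {ι' : Type*} [Fintype ι'] [DecidableEq ι']
  {V : Type*} [AddCommGroup V] [Module k V]

/-- **The origin normal form, block by block.**  For symmetric `A₀` on `Unit ⊕ ι'` with
`A₀ w = 0`, `w_{inl} ≠ 0`, `rank A₀ ≥ |ι'|`, and a linear family `M` of symmetric matrices: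
`D := (A₀)₂₂` is invertible and symmetric, and
`w_{inl}² det (A₀ + s M(z)) = det [[s wᵀM(z)w, s b(z)ᵀ], [s b(z), D + s (M z)₂₂]]` with
`b(z)_i = (M(z) w)_{inr i}`. [folklore] -/
theorem det_origin_blocks (A₀ : Matrix (Unit ⊕ ι') (Unit ⊕ ι') k) (hA₀s : A₀ᵀ = A₀)
    (w : Unit ⊕ ι' → k) (hw0 : w (Sum.inl ()) ≠ 0) (hA₀w : A₀ *ᵥ w = 0)
    (hrank : Fintype.card ι' ≤ A₀.rank) (M : V →ₗ[k] Matrix (Unit ⊕ ι') (Unit ⊕ ι') k)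
    (hMs : ∀ v, (M v)ᵀ = M v) :
    IsUnit (A₀.toBlocks₂₂).det ∧ (A₀.toBlocks₂₂)ᵀ = A₀.toBlocks₂₂ ∧
      (∀ v, ((M v).toBlocks₂₂)ᵀ = (M v).toBlocks₂₂) ∧
      ∀ (s : k) (v : V), w (Sum.inl ()) ^ 2 * (A₀ + s • M v).det =
        (Matrix.fromBlocks ((s * (w ⬝ᵥ M v *ᵥ w)) • (1 : Matrix Unit Unit k))
          (Matrix.replicateRow Unit (s • fun i => (M v *ᵥ w) (Sum.inr i)))
          (Matrix.replicateCol Unit (s • fun i => (M v *ᵥ w) (Sum.inr i)))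
          (A₀.toBlocks₂₂ + s • (M v).toBlocks₂₂)).det := by
  classical
  -- the congruence matrix `P` with first column `w`
  set P : Matrix (Unit ⊕ ι') (Unit ⊕ ι') k := Matrix.fromBlocks (w (Sum.inl ()) • 1) 0
    (Matrix.replicateCol Unit fun i => w (Sum.inr i)) 1 with hPdef
  have hPcol : ∀ b, P b (Sum.inl ()) = w b := by
    rintro (b | b)
    · simp [hPdef]
    · simp [hPdef]
  have hPinr : ∀ (b : Unit ⊕ ι') (j : ι'), P b (Sum.inr j) = if b = Sum.inr j then 1 else 0 := by
    rintro (b | b) j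
    · simp [hPdef]
    · simp [hPdef, Matrix.one_apply]
  have hPdet : P.det = w (Sum.inl ()) := by
    rw [hPdef, Matrix.det_fromBlocks_zero₁₂, Matrix.det_one, mul_one, Matrix.det_smul,
      Matrix.det_one, mul_one, Fintype.card_unit, pow_one]
  have hPu : IsUnit P.det := isUnit_iff_ne_zero.2 (by rw [hPdet]; exact hw0)
  have hPtu : IsUnit Pᵀ.det := by rwa [Matrix.det_transpose]
  have hcol : ∀ (N : Matrix (Unit ⊕ ι') (Unit ⊕ ι') k) (i : Unit ⊕ ι'),
      (Pᵀ * N * P) i (Sum.inl ()) = (Pᵀ *ᵥ (N *ᵥ w)) i := by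
    intro N i
    rw [Matrix.mulVec_mulVec, Matrix.mul_apply, Matrix.mulVec, dotProduct]
    simp_rw [hPcol]
  have hrow : ∀ (u : Unit ⊕ ι' → k), (Pᵀ *ᵥ u) (Sum.inl ()) = w ⬝ᵥ u := by
    intro u
    simp only [Matrix.mulVec, dotProduct, Matrix.transpose_apply, hPcol]
  have hrow' : ∀ (u : Unit ⊕ ι' → k) (i : ι'), (Pᵀ *ᵥ u) (Sum.inr i) = u (Sum.inr i) := by
    intro u i
    simp only [Matrix.mulVec, dotProduct, Matrix.transpose_apply, hPinr, ite_mul, one_mul,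
      zero_mul, Finset.sum_ite_eq', Finset.mem_univ, if_true]
  have hblock : ∀ (N : Matrix (Unit ⊕ ι') (Unit ⊕ ι') k) (i j : ι'),
      (Pᵀ * N * P) (Sum.inr i) (Sum.inr j) = N (Sum.inr i) (Sum.inr j) := by
    intro N i j
    simp only [Matrix.mul_apply, Matrix.transpose_apply, hPinr, ite_mul, one_mul, zero_mul,
      mul_ite, mul_one, mul_zero, Finset.sum_ite_eq', Finset.mem_univ, if_true]
  have hsymm : ∀ N : Matrix (Unit ⊕ ι') (Unit ⊕ ι') k, Nᵀ = N → (Pᵀ * N * P)ᵀ = Pᵀ * N * P := by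
    intro N hN
    rw [Matrix.transpose_mul, Matrix.transpose_mul, Matrix.transpose_transpose, hN,
      Matrix.mul_assoc]
  -- normal form of `A₀`
  set D : Matrix ι' ι' k := A₀.toBlocks₂₂ with hDdef
  have hAnf : Pᵀ * A₀ * P = Matrix.fromBlocks 0 0 0 D := by
    have hc : ∀ i, (Pᵀ * A₀ * P) i (Sum.inl ()) = 0 := fun i => by
      rw [hcol, hA₀w, Matrix.mulVec_zero, Pi.zero_apply]
    ext (i | i) (j | j)
    · rw [hc]; simp
    · have h := hc (Sum.inr j)
      rw [← hsymm A₀ hA₀s, Matrix.transpose_apply] at h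
      rw [h]; simp
    · rw [hc]; simp
    · rw [hblock]; simp [hDdef, Matrix.toBlocks₂₂]
  have hbs : ∀ N : Matrix (Unit ⊕ ι') (Unit ⊕ ι') k, Nᵀ = N → (N.toBlocks₂₂)ᵀ = N.toBlocks₂₂ := by
    intro N hN
    ext i j
    simp only [Matrix.toBlocks₂₂, Matrix.transpose_apply, Matrix.of_apply]
    rw [← hN, Matrix.transpose_apply, hN]
  have hDs : Dᵀ = D := hbs A₀ hA₀s
  have hr0 : ∀ X : Matrix ι' ι' k,
      (Matrix.fromBlocks (0 : Matrix Unit Unit k) 0 0 X).rank ≤ X.rank := by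
    intro X
    have hf : Matrix.fromBlocks (0 : Matrix Unit Unit k) 0 0 X =
        Matrix.fromRows (0 : Matrix Unit ι' k) (1 : Matrix ι' ι' k) * X *
          Matrix.fromCols (0 : Matrix ι' Unit k) (1 : Matrix ι' ι' k) := by
      rw [Matrix.fromRows_mul, Matrix.fromRows_mul_fromCols]
      simp
    rw [hf]
    exact (Matrix.rank_mul_le_left _ _).trans (Matrix.rank_mul_le_right _ _)
  have hrP : ∀ X : Matrix (Unit ⊕ ι') (Unit ⊕ ι') k, (Pᵀ * X * P).rank = X.rank := fun X => by
    rw [Matrix.rank_mul_eq_left_of_isUnit_det _ _ hPu,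
      Matrix.rank_mul_eq_right_of_isUnit_det _ _ hPtu]
  have hD : IsUnit D.det := by
    rw [isUnit_iff_ne_zero]
    intro hD0
    have hlt := Matrix.rank_lt_card_of_det_eq_zero hD0
    have h2 := hr0 D
    rw [← hAnf, hrP] at h2
    omega
  -- normal form of `M v`
  have hMnf : ∀ v, Pᵀ * M v * P = Matrix.fromBlocks ((w ⬝ᵥ M v *ᵥ w) • (1 : Matrix Unit Unit k))
      (Matrix.replicateRow Unit fun i => (M v *ᵥ w) (Sum.inr i))
      (Matrix.replicateCol Unit fun i => (M v *ᵥ w) (Sum.inr i)) (M v).toBlocks₂₂ := by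
    intro v
    have h := eq_fromBlocks_of_col (hsymm _ (hMs v)) (a := w ⬝ᵥ M v *ᵥ w)
      (b := fun i => (M v *ᵥ w) (Sum.inr i)) (by rw [hcol, hrow]) (fun i => by rw [hcol, hrow'])
    have hB : (Pᵀ * M v * P).toBlocks₂₂ = (M v).toBlocks₂₂ := by
      ext i j
      simp only [Matrix.toBlocks₂₂, Matrix.of_apply, hblock]
    rw [hB] at h
    exact h
  refine ⟨hD, hDs, fun v => hbs _ (hMs v), fun s v => ?_⟩
  have hconj : Pᵀ * (A₀ + s • M v) * P =
      Matrix.fromBlocks ((s * (w ⬝ᵥ M v *ᵥ w)) • (1 : Matrix Unit Unit k))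
        (Matrix.replicateRow Unit (s • fun i => (M v *ᵥ w) (Sum.inr i)))
        (Matrix.replicateCol Unit (s • fun i => (M v *ᵥ w) (Sum.inr i)))
        (D + s • (M v).toBlocks₂₂) := by
    rw [Matrix.mul_add, Matrix.add_mul, Matrix.mul_smul, Matrix.smul_mul, hAnf, hMnf,
      fromBlocks_add_smul]
  have hdet := congr_arg Matrix.det hconj
  rw [Matrix.det_mul, Matrix.det_mul, Matrix.det_transpose, hPdet] at hdet
  rw [← hdet]
  ring

end Summit.ValiantsHypothesis.ValiantsHypothesis.Theorems.SymPencilOriginNormalForm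

end
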